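import Summits.CriticalPhenomena.PercolationContinuityZ3.Theorems.Transplant.CayleyNilpotentVirtuallyCyclic
import Summits.CriticalPhenomena.PercolationContinuityZ3.Theorems.Transplant.CayleyZSqCriticalProbLtOne
import Summits.CriticalPhenomena.PercolationContinuityZ3.Theorems.Transplant.CayleyVirtuallyCyclicCriticalProbOne
import Summits.CriticalPhenomena.PercolationContinuityZ3.Theorems.Transplant.NilpotentCommutingPair
import Mathlib.GroupTheory.Schreier
import HarnessLib

/-!
# Benjamini–Schramm's Conjecture 1 for VIRTUALLY NILPOTENT groups, kernel and in `⟺` form: `p_c(Cay(Γ; S)) < 1 ⟺ Γ` is not virtually cyclic —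
# Lyons–Peres' Cor. 7.19 with Gromov's theorem replaced by the hypothesis (unconditional)

builds on p205010 (kernel theorem, internal audit signed; external expert review pending) — nothing in this file uses p205010; unconditional, no node.
Lane `prim-bschramm`, seat `prim-bschramm-p4` gen 22 (PART C3 of `P4-GENERAL.md` §44).  Helper file (`--supports stmt-CriticalPhenomena-4575 --as helper`).

THE POINT.  The hypothesis side of Conjecture 4 on class C2 (Cayley graphs of polynomial growth = of virtually nilpotent groups, by Gromov): for a
finitely generated group `Γ` with a finite-index NILPOTENT subgroup `N` and ANY finite generating set `S`,
**`VirtNilpotent.criticalProb_lt_one_iff_not_virtuallyCyclic : p_c(Cay(Γ; S), g) < 1 ⟺ ¬ ∃ c, [Γ : ⟨c⟩] < ∞`**.  Assembly of four gen-22 kernel facts: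
`⟹` is `VirtCyc.not_virtuallyCyclic_of_criticalProb_lt_one` (a finite-index cyclic subgroup forces `p_c = 1`); `⟸`: `N` is finitely generated
(Schreier, Mathlib `Subgroup.fg_of_index_ne_zero`) and not virtually cyclic (index multiplicativity), so it has two independent characters
(`Nilpotent.virtuallyCyclic_iff_dependent`), so it contains an embedded `ℤ²` (`NilPair.exists_commuting_independent_pair`), which forces
`p_c < 1` for every generating set of `Γ` (`CayleyZSq.criticalProb_lt_one`).  So on the WHOLE virtually nilpotent class (wall included) the
hypothesis `p_c < 1` of Conjecture 4 is decided by a kernel theorem; what the conclusion `θ(p_c) = 0` still needs there is `b₁(Γ) ≥ 2` (mod `U_s`)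
— the wall is exactly `b₁(Γ) ≤ 1 < vb₁(Γ)`.
* `Nilpotent.exists_commuting_independent_pair_of_not_virtuallyCyclic`, `finiteIndex_zpowers_of_subgroup`,
  **`VirtNilpotent.criticalProb_lt_one_iff_not_virtuallyCyclic`**, `VirtNilpotent.criticalProb_eq_one_iff_virtuallyCyclic`,
  `VirtNilpotent.criticalProb_lt_one_of_not_virtuallyCyclic_of_injective` (the subgroup given as an injective homomorphism from a nilpotent group).
[cite: BenjaminiSchramm1996, §2 Conj. 1 and the remark after it] [cite: LyonsPeres2016, §7.4 Thm. 7.15, Thm. 7.18, Cor. 7.19; §7.9]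
-/

noncomputable section

namespace Summit.CriticalPhenomena.PercolationContinuityZ3.Theorems.Transplant
open SimpleGraph Literature.Probability.LatticeModels Literature.Probability.Percolation
open scoped Classical

/-- **A finitely generated nilpotent group that is not virtually cyclic contains `ℤ²`.** [cite: LyonsPeres2016, §7.9 (proof of Thm. 7.18)] -/
theorem Nilpotent.exists_commuting_independent_pair_of_not_virtuallyCyclic {Γ : Type} [Group Γ] [Group.IsNilpotent Γ] (A : Finset Γ)
    (hA : Subgroup.closure (A : Set Γ) = ⊤) (hnvc : ¬ ∃ c : Γ, (Subgroup.zpowers c).FiniteIndex) :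
    ∃ x y : Γ, Commute x y ∧ ∀ m n : ℤ, x ^ m * y ^ n = 1 → m = 0 ∧ n = 0 := by
  rw [Nilpotent.virtuallyCyclic_iff_dependent A hA] at hnvc
  push Not at hnvc
  obtain ⟨ψ₀, ψ₁, a, b, hind⟩ := hnvc
  obtain ⟨c, hc⟩ := (Subgroup.nilpotent_iff_lowerCentralSeries (G := Γ)).1 inferInstance
  exact NilPair.exists_commuting_independent_pair hc ψ₀ ψ₁ a b hind

namespace VirtNilpotent

variable {Γ : Type} [Group Γ]

/-- A finite-index cyclic subgroup of a finite-index subgroup is a finite-index cyclic subgroup of the group. [folklore] -/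
theorem finiteIndex_zpowers_of_subgroup (N : Subgroup Γ) [N.FiniteIndex] (c : N) (hc : (Subgroup.zpowers c).FiniteIndex) :
    (Subgroup.zpowers (c : Γ)).FiniteIndex := by
  have e : Subgroup.zpowers (c : Γ) = (Subgroup.zpowers c).map N.subtype := by rw [MonoidHom.map_zpowers]; rfl
  rw [e]
  refine ⟨?_⟩
  rw [Subgroup.index_map_subtype]
  exact mul_ne_zero hc.index_ne_zero Subgroup.FiniteIndex.index_ne_zero

/-- **THEOREM (Benjamini–Schramm's Conjecture 1 for virtually nilpotent groups, kernel, `⟺` form).**  `Γ = ⟨S⟩` (`S` finite, arbitrary) with a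
finite-index NILPOTENT subgroup `N`: `p_c(Cay(Γ; S), g) < 1 ⟺ Γ` is not virtually cyclic.
[cite: BenjaminiSchramm1996, §2 Conj. 1 and the remark after it] [cite: LyonsPeres2016, §7.4 Thm. 7.15, Thm. 7.18, Cor. 7.19] -/
theorem criticalProb_lt_one_iff_not_virtuallyCyclic (S : Finset Γ) (hS : Subgroup.closure (S : Set Γ) = ⊤) (N : Subgroup Γ) [N.FiniteIndex]
    [Group.IsNilpotent N] (g : Γ) : criticalProb (mulCayley (↑S : Set Γ)) g < 1 ↔ ¬ ∃ c : Γ, (Subgroup.zpowers c).FiniteIndex := by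
  refine ⟨VirtCyc.not_virtuallyCyclic_of_criticalProb_lt_one S hS g, fun hnvc => ?_⟩
  -- `N` is finitely generated (Schreier) and not virtually cyclic
  haveI : Group.FG Γ := ⟨⟨S, hS⟩⟩
  haveI : Group.FG N := Subgroup.fg_of_index_ne_zero N
  obtain ⟨-, A, -, hA⟩ := Group.fg_iff'.1 (inferInstance : Group.FG N)
  have hN : ¬ ∃ c : N, (Subgroup.zpowers c).FiniteIndex := fun ⟨c, hc⟩ => hnvc ⟨(c : Γ), finiteIndex_zpowers_of_subgroup N c hc⟩
  obtain ⟨x, y, hxy, hind⟩ := Nilpotent.exists_commuting_independent_pair_of_not_virtuallyCyclic A hA hN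
  refine CayleyZSq.criticalProb_lt_one S hS (a := (x : Γ)) (b := (y : Γ)) (congrArg Subtype.val hxy.eq) (fun m n h => hind m n ?_) g
  apply Subtype.ext
  rw [Subgroup.coe_mul, Subgroup.coe_zpow, Subgroup.coe_zpow, Subgroup.coe_one]
  exact h

/-- **… equivalently `p_c(Cay(Γ; S), g) = 1 ⟺ Γ` IS virtually cyclic.** [cite: BenjaminiSchramm1996, §2 Conj. 1] -/
theorem criticalProb_eq_one_iff_virtuallyCyclic (S : Finset Γ) (hS : Subgroup.closure (S : Set Γ) = ⊤) (N : Subgroup Γ) [N.FiniteIndex]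
    [Group.IsNilpotent N] (g : Γ) : criticalProb (mulCayley (↑S : Set Γ)) g = 1 ↔ ∃ c : Γ, (Subgroup.zpowers c).FiniteIndex := by
  have hle : criticalProb (mulCayley (↑S : Set Γ)) g ≤ 1 := (criticalProb_mem_Icc _ _).2
  have h := criticalProb_lt_one_iff_not_virtuallyCyclic S hS N g
  constructor
  · intro h1; by_contra hvc; exact absurd (h.2 hvc) (by rw [h1]; exact lt_irrefl 1)
  · intro hvc; by_contra hne; exact h.1 (lt_of_le_of_ne hle hne) hvc

/-- **Injective-homomorphism form**: `φ : N → Γ` injective from a NILPOTENT group with image of finite index; if `Γ` is not virtually cyclic then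
`p_c(Cay(Γ; S), g) < 1` for every finite generating `S`. [cite: BenjaminiSchramm1996, §2 Conj. 1 and the remark after it] -/
theorem criticalProb_lt_one_of_not_virtuallyCyclic_of_injective (S : Finset Γ) (hS : Subgroup.closure (S : Set Γ) = ⊤) {N : Type} [Group N]
    [Group.IsNilpotent N] (φ : N →* Γ) (hfi : φ.range.FiniteIndex) (hnvc : ¬ ∃ c : Γ, (Subgroup.zpowers c).FiniteIndex) (g : Γ) :
    criticalProb (mulCayley (↑S : Set Γ)) g < 1 := by
  haveI := hfi
  haveI : Group.IsNilpotent φ.range := Group.nilpotent_of_surjective φ.rangeRestrict φ.rangeRestrict_surjective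
  exact (criticalProb_lt_one_iff_not_virtuallyCyclic S hS φ.range g).2 hnvc

end VirtNilpotent

end Summit.CriticalPhenomena.PercolationContinuityZ3.Theorems.Transplant
end
-- build-touch 2026-08-25T07:13:01Z T1-B (lead g18): re-land of p391724, declarations byte-identical
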